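import Mathlib
import HarnessLib
import Literature.Analysis.FluidPDE.LocalTypeIBlowup.SingularVertexZoom

/-!
# Blow-up at a local Type I singular point, file 14: the zoom at prescribed backward singular
# vertices of a SEQUENCE of solutions, with prescribed scales (Barker–Prange 2020, §4 Steps 2–3
# with Lemma 3; Seregin–Šverák 2009, Thm. 2.8; Albritton–Barker 2019, Prop. 2.3)

Analysis/FluidPDE proof file (theorems only: no definition, no named fact, no `sorry`), fourteenth
file of the Literature series `LocalTypeIBlowup/*`.  File 13 (`SingularVertexZoom`) zooms ONE suitable
weak solution at ONE backward singular vertex along prescribed scales `R n → 0`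
(`exists_typeIAncientMild_zoomLimit`).  Barker–Prange's remark (arXiv:1906.08225 p. 5: "the main
flexibility of our method lies in the fact that we can use any sequence `R⁽ᵏ⁾ ↓ 0` in the rescaling
procedure") applies verbatim when the SOLUTION and the VERTEX also vary along the sequence inside a
class with UNIFORM constants — the compactness engine `local_typeI_compactness_singular`
(Albritton–Barker §3 + persistence of singularities) and the `C¹_loc` upgrade `exists_subseq_curl_limit`
only ever see the sequence of zoomed pairs and their uniform bounds.  This file records that version:

* `exists_typeIAncientMild_zoomLimit_seq` — let `(u_n, p_n)` be suitable weak solutions in the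
  parabolic balls `Q(z_n, ρ)` (one radius `ρ`), with weak gradients `G_n`, a UNIFORM local Type-I bound
  `𝐈(Q(z_n, ρ); u_n, p_n, G_n) ≤ I < ∞`, each `u_n` continuous on its ball with the UNIFORM rate
  `‖u_n(t,x)‖ ≤ M/√(t_n − t)`, and each `z_n` a backward singular point of `u_n`; let `R_n → 0⁺`.  Then
  along a subsequence `φ` the zooms `R u_{φ j}(t_{φ j} + R² s, x_{φ j} + R y)`, `R = R_{φ j}`, converge —
  in `L³(Q(0, r))` for every `r`, pointwise on `s < −1` together with their curls — to a field `U` of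
  the class `IsTypeIAncientMild M U` which, with a pressure and a weak gradient, is a suitable weak
  solution on the backward slab with `𝐈 < ∞` and a BACKWARD SINGULAR POINT AT THE ORIGIN.

The proof is that of `exists_typeIAncientMild_zoomLimit` with indices (Steps 1–2 re-indexed; Steps 3–7
unchanged), plus the export of the strong `L³_loc` convergence along the final subsequence.  Consumer
(summit side): the «local point zoom ACROSS solutions of one class» of the door family of
NavierStokesRegularity (class-uniform one-time ε-doors).  Nothing here is a claim about Navier–Stokes
regularity; no new notion is introduced.

## References

* T. Barker, C. Prange, Arch. Ration. Mech. Anal. 235 (2020) 881–926 = arXiv:1906.08225: §1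
  Lemma 3 (p. 4), remark p. 5, §4 proof of Thm. 1 Steps 2–3 (pp. 16–17). [BarkerPrange2020Alignment]
* G. Seregin, V. Šverák, Comm. PDE 34 (2009) = arXiv:0804.1803, Thm. 2.8, §4 p. 11. [SereginSverak2009]
* D. Albritton, T. Barker, J. Math. Fluid Mech. 21 (2019) = arXiv:1811.00502, Lemma 2.2, Prop. 2.3,
  §3. [AlbrittonBarker2019]
* W. Rusin, V. Šverák, J. Funct. Anal. 260 (2011), Lemma 2.1. [RusinSverak2011]
* G. Koch, N. Nadirashvili, G. Seregin, V. Šverák, Acta Math. 203 (2009) = arXiv:0709.3599,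
  Lemma 3.1, §4 (i), Prop. 4.1, Lemma 6.1. [KochNadirashviliSereginSverak2009]
-/

noncomputable section

open MeasureTheory Set Function Filter Topology TopologicalSpace Metric
open scoped NNReal ENNReal
open Literature.Analysis Literature.Analysis.FluidPDE

namespace Literature.Analysis.FluidPDE.LocalTypeIBlowup

/-! ### Two measure-theoretic trivia (copies of the private helpers of file 13) -/

/-- Strong `L³` convergence on a set has an a.e. convergent subsequence. [folklore] -/
private theorem exists_subseq_tendsto_ae' {Q₀ : Set (ℝ × (EuclideanSpace ℝ (Fin 3)))}
    {v : ℕ → ℝ → (EuclideanSpace ℝ (Fin 3)) → (EuclideanSpace ℝ (Fin 3))}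
    {U : ℝ → (EuclideanSpace ℝ (Fin 3)) → (EuclideanSpace ℝ (Fin 3))}
    (hv : ∀ k, AEStronglyMeasurable (uncurry (v k)) (volume.restrict Q₀))
    (hU : AEStronglyMeasurable (uncurry U) (volume.restrict Q₀))
    (hconv : Tendsto (fun k => eLpNorm (uncurry (v k) - uncurry U) 3 (volume.restrict Q₀))
      atTop (𝓝 0)) :
    ∃ φ : ℕ → ℕ, StrictMono φ ∧ ∀ᵐ w ∂(volume.restrict Q₀),
      Tendsto (fun i => uncurry (v (φ i)) w) atTop (𝓝 (uncurry U w)) :=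
  (tendstoInMeasure_of_tendsto_eLpNorm (by norm_num) hv hU hconv).exists_seq_tendsto_ae

/-- Every point of the open backward slab lies in some `Q(0, 2ᵐ)`. [folklore] -/
private theorem exists_mem_parabolicCylinder_two_pow {t : ℝ} (ht : t < 0) (x : EuclideanSpace ℝ (Fin 3)) :
    ∃ m : ℕ, ((t, x) : ℝ × (EuclideanSpace ℝ (Fin 3))) ∈
      parabolicCylinder ((2 : ℝ) ^ m) (0 : ℝ × (EuclideanSpace ℝ (Fin 3))) := by
  obtain ⟨m, hm⟩ := pow_unbounded_of_one_lt (max (-t) ‖x‖ + 1) (by norm_num : (1 : ℝ) < 2)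
  refine ⟨m, ?_⟩
  have h1 : (1 : ℝ) ≤ (2 : ℝ) ^ m := one_le_pow₀ (by norm_num)
  have h2 : -t < (2 : ℝ) ^ m := by linarith [le_max_left (-t) ‖x‖]
  have h3 : ‖x‖ < (2 : ℝ) ^ m := by linarith [le_max_right (-t) ‖x‖]
  rw [mem_parabolicCylinder]
  simp only [Prod.fst_zero, Prod.snd_zero, zero_sub, dist_zero_right]
  refine ⟨⟨?_, ht⟩, h3⟩
  nlinarith

/-! ### The zoom at prescribed backward singular vertices of a sequence of solutions -/

/-- **The zoom at prescribed backward singular vertices of a SEQUENCE of solutions, with prescribed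
scales** (Barker–Prange 2020, §4 proof of Thm. 1, Steps 2–3, with the remark of p. 5 that any sequence of
scales may be used; Seregin–Šverák 2009, Thm. 2.8 / §4 p. 11; Albritton–Barker 2019, Prop. 2.3).  Let
`(u_n, p_n)` be suitable weak solutions in the parabolic balls `Q(z_n, ρ)` (Albritton–Barker's class
Def. 2.1), with weak gradients `G_n`, the UNIFORM bound `𝐈(Q(z_n, ρ)) ≤ I < ∞`, `u_n` continuous on
`Q(z_n, ρ)` with the uniform Type-I RATE `‖u_n(t,x)‖ ≤ M/√(t_n − t)` (`z_n = (t_n, x_n)`), and `z_n` a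
backward singular point of `u_n`.  Let `R n > 0`, `R n → 0`.  Then there are a subsequence `φ` and a field
`U` of the class `IsTypeIAncientMild M U` which, with a pressure `P` and a weak gradient `H`, is a suitable
weak solution on the backward slab `(−∞, 0) × ℝ³` with `𝐈 < ∞` and a **backward singular point at the
origin**, such that the zooms `R u_{φ j}(t_{φ j} + R² s, x_{φ j} + R y)`, `R = R (φ j)`, converge to `U` in
`L³(Q(0, r))` for every `r > 0`, and for every `s < −1` and every `y` pointwise at `(s, y)` together with
their curls.  (Proof = file 13's `exists_typeIAncientMild_zoomLimit` with indices.)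
[cite: BarkerPrange2020Alignment, §4 proof of Thm. 1 Steps 2–3, Lemma 3 and remark p. 5 (arXiv:1906.08225 pp. 4–5, 16–17); SereginSverak2009, Thm 2.8 and §4 p. 11; AlbrittonBarker2019, Prop. 2.3 and §3] -/
theorem exists_typeIAncientMild_zoomLimit_seq
    {u : ℕ → ℝ → (EuclideanSpace ℝ (Fin 3)) → (EuclideanSpace ℝ (Fin 3))}
    {p : ℕ → ℝ → (EuclideanSpace ℝ (Fin 3)) → ℝ}
    {G : ℕ → ℝ → (EuclideanSpace ℝ (Fin 3)) → (EuclideanSpace ℝ (Fin 3)) →L[ℝ] (EuclideanSpace ℝ (Fin 3))}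
    {z₀ : ℕ → ℝ × (EuclideanSpace ℝ (Fin 3))} {ρ M : ℝ} (hρ : 0 < ρ) {I : ℝ≥0∞} (hI : I < ⊤)
    (hball : ∀ n, IsSuitableWeakSolutionInBall ρ (z₀ n) (u n) (p n))
    (hwg : ∀ n, HasWeakSpatialGradientOn (parabolicCylinderOpens ρ (z₀ n)) (u n) (G n))
    (hIn : ∀ n, typeIBound (parabolicCylinder ρ (z₀ n)) (u n) (p n) (G n) ≤ I)
    (hcont : ∀ n, ContinuousOn (uncurry (u n)) (parabolicCylinder ρ (z₀ n)))
    (hrate : ∀ (n : ℕ) (t : ℝ) (x : EuclideanSpace ℝ (Fin 3)), (t, x) ∈ parabolicCylinder ρ (z₀ n) →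
      ‖u n t x‖ ≤ M / Real.sqrt ((z₀ n).1 - t))
    (hsing : ∀ n, IsBackwardSingularPoint (u n) (z₀ n))
    {R : ℕ → ℝ} (hR : ∀ n, 0 < R n) (hR0 : Tendsto R atTop (𝓝 0)) :
    ∃ φ : ℕ → ℕ, StrictMono φ ∧
      ∃ (U : ℝ → (EuclideanSpace ℝ (Fin 3)) → (EuclideanSpace ℝ (Fin 3)))
        (P : ℝ → (EuclideanSpace ℝ (Fin 3)) → ℝ)
        (H : ℝ → (EuclideanSpace ℝ (Fin 3)) → (EuclideanSpace ℝ (Fin 3)) →L[ℝ] (EuclideanSpace ℝ (Fin 3))),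
        IsTypeIAncientMild M U ∧
        IsSuitableWeakSolutionOn (slab (EuclideanSpace ℝ (Fin 3)) (Iio 0) isOpen_Iio) 1 0 U P ∧
        HasWeakSpatialGradientOn (slab (EuclideanSpace ℝ (Fin 3)) (Iio 0) isOpen_Iio) U H ∧
        typeIBound (Iio (0 : ℝ) ×ˢ univ) U P H < ⊤ ∧
        IsBackwardSingularPoint U 0 ∧
        (∀ r : ℝ, 0 < r → Tendsto (fun j => eLpNorm
          (uncurry (R (φ j) • stPull (R (φ j) ^ 2) (R (φ j)) (z₀ (φ j)).1 (z₀ (φ j)).2 (u (φ j))) - uncurry U) 3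
          (volume.restrict (parabolicCylinder r (0 : ℝ × (EuclideanSpace ℝ (Fin 3)))))) atTop (𝓝 0)) ∧
        (∀ s < (-1 : ℝ), ∀ y : EuclideanSpace ℝ (Fin 3),
          Tendsto (fun j => R (φ j) • u (φ j) ((z₀ (φ j)).1 + R (φ j) ^ 2 * s) ((z₀ (φ j)).2 + R (φ j) • y)) atTop
            (𝓝 (U s y))) ∧
        (∀ s < (-1 : ℝ), ∀ y : EuclideanSpace ℝ (Fin 3),
          Tendsto (fun j => R (φ j) ^ 2 • curl (u (φ j) ((z₀ (φ j)).1 + R (φ j) ^ 2 * s)) ((z₀ (φ j)).2 + R (φ j) • y))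
            atTop (𝓝 (curl (U s) y))) := by
  -- ## constants
  have hρ2 : 0 < ρ ^ 2 := pow_pos hρ 2
  have hM : 0 ≤ M := by
    have hmem : (((z₀ 0).1 - ρ ^ 2 / 2, (z₀ 0).2) : ℝ × (EuclideanSpace ℝ (Fin 3))) ∈ parabolicCylinder ρ (z₀ 0) := by
      rw [mem_parabolicCylinder]
      exact ⟨⟨by linarith, by linarith⟩, by simp [hρ]⟩
    have h := hrate 0 _ _ hmem
    have hs : 0 < Real.sqrt ((z₀ 0).1 - ((z₀ 0).1 - ρ ^ 2 / 2)) := Real.sqrt_pos.2 (by linarith)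
    by_contra hM
    push Not at hM
    linarith [norm_nonneg (u 0 ((z₀ 0).1 - ρ ^ 2 / 2) (z₀ 0).2), div_neg_of_neg_of_pos hM hs]
  have hcc_pos : ∀ m : ℕ, (0 : ℝ) < (2 : ℝ) ^ m := fun m => by positivity
  -- ## Step 1: fast scales `lam k = R (φ₀ k) ≤ ρ / 2^(k+2)`
  have hev : ∀ k : ℕ, ∀ᶠ n in atTop, R n ≤ ρ / (2 : ℝ) ^ (k + 2) := fun k =>
    (hR0.eventually (Iic_mem_nhds (by positivity : (0 : ℝ) < ρ / (2 : ℝ) ^ (k + 2)))).mono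
      fun n hn => hn
  obtain ⟨φ₀, hφ₀, hφ₀R⟩ := extraction_forall_of_eventually hev
  set lam : ℕ → ℝ := fun k => R (φ₀ k) with hlam
  have hlam0 : ∀ k, 0 < lam k := fun k => hR (φ₀ k)
  have hbig : ∀ k, (2 : ℝ) ^ (k + 2) ≤ ρ / lam k := fun k => by
    rw [le_div_iff₀ (hlam0 k)]
    have h := hφ₀R k
    rw [le_div_iff₀ (hcc_pos (k + 2))] at h
    simpa only [hlam, mul_comm] using h
  -- ## Step 2: the zoomed pairs and their properties
  set v : ℕ → ℝ → (EuclideanSpace ℝ (Fin 3)) → (EuclideanSpace ℝ (Fin 3)) :=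
    fun k => lam k • stPull (lam k ^ 2) (lam k) (z₀ (φ₀ k)).1 (z₀ (φ₀ k)).2 (u (φ₀ k)) with hv
  set qz : ℕ → ℝ → (EuclideanSpace ℝ (Fin 3)) → ℝ :=
    fun k => lam k ^ 2 • stPull (lam k ^ 2) (lam k) (z₀ (φ₀ k)).1 (z₀ (φ₀ k)).2 (p (φ₀ k)) with hqz
  set Gz : ℕ → ℝ → (EuclideanSpace ℝ (Fin 3)) → (EuclideanSpace ℝ (Fin 3)) →L[ℝ] (EuclideanSpace ℝ (Fin 3)) :=
    fun k => lam k ^ 2 • stPull (lam k ^ 2) (lam k) (z₀ (φ₀ k)).1 (z₀ (φ₀ k)).2 (G (φ₀ k)) with hGz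
  -- the class on `Q(0, ρ / lam k)`
  have hInbig : ∀ k, IsSuitableWeakSolutionInBall (ρ / lam k) 0 (v k) (qz k) := by
    intro k
    have h1 := (hball (φ₀ k)).zoom hρ
    set c : ℝ := lam k / ρ with hc
    have hc0 : 0 < c := div_pos (hlam0 k) hρ
    have h2 := h1.zoomOut hc0
    have hcρ : c * ρ = lam k := div_mul_cancel₀ _ hρ.ne'
    have hrad : 1 / c = ρ / lam k := by rw [hc, one_div_div]
    rw [zoom_zoom, zoom_zoom, hcρ, hrad, show c ^ 2 * ρ ^ 2 = lam k ^ 2 by rw [← hcρ]; ring] at h2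
    exact h2
  have hsub : ∀ m k : ℕ, m ≤ k + 2 →
      parabolicCylinder ((2 : ℝ) ^ m) (0 : ℝ × (EuclideanSpace ℝ (Fin 3))) ⊆
        parabolicCylinder (ρ / lam k) (0 : ℝ × (EuclideanSpace ℝ (Fin 3))) := fun m k hmk =>
    parabolicCylinder_mono (hcc_pos m).le ((pow_le_pow_right₀ (by norm_num) hmk).trans (hbig k)) _
  have hballs : ∀ m k : ℕ, m ≤ k + 2 →
      IsSuitableWeakSolutionInBall ((2 : ℝ) ^ m) 0 (v k) (qz k) := fun m k hmk =>
    (hInbig k).of_subset_zero (hcc_pos m) (hsub m k hmk)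
  -- the weak gradients
  have hpre : ∀ k, stPreimage (lam k ^ 2) (lam k) (z₀ (φ₀ k)).1 (z₀ (φ₀ k)).2
      (parabolicCylinderOpens ρ (z₀ (φ₀ k))) =
      parabolicCylinderOpens (ρ / lam k) (0 : ℝ × (EuclideanSpace ℝ (Fin 3))) := fun k =>
    Opens.ext (zoom_preimage_parabolicCylinder (hlam0 k) (z₀ (φ₀ k)) ρ)
  have hgrads : ∀ m k : ℕ, m ≤ k + 2 →
      HasWeakSpatialGradientOn (parabolicCylinderOpens ((2 : ℝ) ^ m) (0 : ℝ × (EuclideanSpace ℝ (Fin 3))))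
        (v k) (Gz k) := by
    intro m k hmk
    have h1 := (hwg (φ₀ k)).stRescale (lam k) (β := lam k ^ 2) (γ := lam k) (pow_pos (hlam0 k) 2) (hlam0 k)
      (z₀ (φ₀ k)).1 (z₀ (φ₀ k)).2
    rw [show lam k * lam k = lam k ^ 2 by ring, hpre k] at h1
    exact h1.mono (fun w hw => hsub m k hmk hw)
  -- the Type I bound
  have hIs : ∀ m k : ℕ, m ≤ k + 2 →
      typeIBound (parabolicCylinder ((2 : ℝ) ^ m) (0 : ℝ × (EuclideanSpace ℝ (Fin 3)))) (v k) (qz k) (Gz k) ≤ I := by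
    intro m k hmk
    refine le_trans ?_ (hIn (φ₀ k))
    rw [← typeIBound_nsZoom (hlam0 k) (z₀ (φ₀ k)).1 (z₀ (φ₀ k)).2 (parabolicCylinder ρ (z₀ (φ₀ k)))
      (u (φ₀ k)) (p (φ₀ k)) (G (φ₀ k)), zoom_preimage_parabolicCylinder (hlam0 k) (z₀ (φ₀ k)) ρ]
    exact typeIBound_mono (hsub m k hmk)
  -- blow-up on every `Q(0, r)`: the vertex `z₀` is singular
  have hst0 : ∀ k, stAffine (lam k ^ 2) (lam k) (z₀ (φ₀ k)).1 (z₀ (φ₀ k)).2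
      (0 : ℝ × (EuclideanSpace ℝ (Fin 3))) = z₀ (φ₀ k) := by
    intro k
    rw [show (0 : ℝ × (EuclideanSpace ℝ (Fin 3))) = ((0 : ℝ), (0 : EuclideanSpace ℝ (Fin 3))) from rfl,
      stAffine_apply, mul_zero, add_zero, smul_zero, add_zero]
  have hblow : ∀ k (r : ℝ), 0 < r →
      eLpNorm (uncurry (v k)) ⊤ (volume.restrict (parabolicCylinder r (0 : ℝ × (EuclideanSpace ℝ (Fin 3))))) = ⊤ := by
    intro k r hr
    show eLpNorm (uncurry (lam k • stPull (lam k ^ 2) (lam k) (z₀ (φ₀ k)).1 (z₀ (φ₀ k)).2 (u (φ₀ k)))) ⊤ _ = ⊤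
    rw [eLpNorm_top_nsZoom (hlam0 k) (z₀ (φ₀ k)).1 (z₀ (φ₀ k)).2 r 0 (u (φ₀ k)), hst0,
      hsing (φ₀ k) (lam k * r) (mul_pos (hlam0 k) hr), ENNReal.mul_top (ENNReal.ofReal_pos.2 (hlam0 k)).ne']
  -- the rate on `Q(0, ρ / lam k)`
  have hratev : ∀ k, ∀ w ∈ parabolicCylinder (ρ / lam k) (0 : ℝ × (EuclideanSpace ℝ (Fin 3))),
      ‖v k w.1 w.2‖ ≤ M / Real.sqrt (-w.1) := by
    rintro k ⟨s, y⟩ hw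
    have hmem := zoom_mem_parabolicCylinder (hlam0 k) (z₀ (φ₀ k)) hw
    rw [stAffine_apply] at hmem
    have hs0 : s < 0 := by
      rw [mem_parabolicCylinder] at hw
      simpa using hw.1.2
    have h := hrate (φ₀ k) _ _ hmem
    have hsq : Real.sqrt ((z₀ (φ₀ k)).1 - ((z₀ (φ₀ k)).1 + lam k ^ 2 * s)) = lam k * Real.sqrt (-s) := by
      rw [show (z₀ (φ₀ k)).1 - ((z₀ (φ₀ k)).1 + lam k ^ 2 * s) = lam k ^ 2 * (-s) by ring,
        Real.sqrt_mul (sq_nonneg _), Real.sqrt_sq (hlam0 k).le]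
    rw [hsq] at h
    have hspos : 0 < Real.sqrt (-s) := Real.sqrt_pos.2 (by linarith)
    show ‖(lam k • stPull (lam k ^ 2) (lam k) (z₀ (φ₀ k)).1 (z₀ (φ₀ k)).2 (u (φ₀ k))) s y‖ ≤ M / Real.sqrt (-s)
    rw [smul_stPull_apply, norm_smul, Real.norm_of_nonneg (hlam0 k).le, le_div_iff₀ hspos]
    have h' := (le_div_iff₀ (mul_pos (hlam0 k) hspos)).1 h
    calc lam k * ‖u (φ₀ k) ((z₀ (φ₀ k)).1 + lam k ^ 2 * s) ((z₀ (φ₀ k)).2 + lam k • y)‖ * Real.sqrt (-s)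
        = ‖u (φ₀ k) ((z₀ (φ₀ k)).1 + lam k ^ 2 * s) ((z₀ (φ₀ k)).2 + lam k • y)‖ * (lam k * Real.sqrt (-s)) := by
          ring
      _ ≤ M := h'
  -- continuity of the zooms on `Q(0, ρ / lam k)`
  have hvc : ∀ k, ContinuousOn (uncurry (v k))
      (parabolicCylinder (ρ / lam k) (0 : ℝ × (EuclideanSpace ℝ (Fin 3)))) := by
    intro k
    have e : uncurry (v k) = fun w => lam k •
        (uncurry (u (φ₀ k)) ∘ stAffine (lam k ^ 2) (lam k) (z₀ (φ₀ k)).1 (z₀ (φ₀ k)).2) w := by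
      funext w
      rfl
    rw [e]
    refine ContinuousOn.const_smul ((hcont (φ₀ k)).comp (continuous_stAffine _ _ _ _).continuousOn ?_) (lam k)
    exact fun w hw => zoom_mem_parabolicCylinder (hlam0 k) (z₀ (φ₀ k)) hw
  -- ## Step 3: compactness with persistence of the singularity
  obtain ⟨Ut, Pt, Ht, σ, hσ, hswU, hHU, h4I, hmemU, hconvU, hpers⟩ :=
    local_typeI_compactness_singular I v qz Gz hI (fun m k hmk => hballs m k (by omega))
      (fun m k hmk => hgrads m k (by omega)) (fun m k hmk => hIs m k (by omega))
  have hσge : ∀ j, j ≤ σ j := fun j => hσ.id_le j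
  have hsingU : IsBackwardSingularPoint Ut 0 := hpers fun r hr => by
    simp only [hblow _ r hr]
    exact limsup_const ⊤
  have h4Itop : typeIBound (Iio (0 : ℝ) ×ˢ univ) Ut Pt Ht < ⊤ :=
    lt_of_le_of_lt h4I (ENNReal.mul_lt_top (by simp) hI)
  -- ## Step 4: the rate, almost everywhere on the slab
  have hrate_ae : ∀ᵐ w ∂(volume.restrict (Iio (0 : ℝ) ×ˢ (univ : Set (EuclideanSpace ℝ (Fin 3))))),
      ‖Ut w.1 w.2‖ ≤ M / Real.sqrt (-w.1) := by
    have hQ : ∀ m : ℕ, ∀ᵐ w ∂(volume.restrict (parabolicCylinder ((2 : ℝ) ^ m) (0 : ℝ × (EuclideanSpace ℝ (Fin 3))))),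
        ‖Ut w.1 w.2‖ ≤ M / Real.sqrt (-w.1) := by
      intro m
      have hmeas : ∀ j, AEStronglyMeasurable (uncurry (v (σ (j + m))))
          (volume.restrict (parabolicCylinder ((2 : ℝ) ^ m) (0 : ℝ × (EuclideanSpace ℝ (Fin 3))))) := fun j =>
        (hballs m (σ (j + m)) (by linarith [hσge (j + m)])).1.distributional.1.aestronglyMeasurable
      obtain ⟨ψ₁, hψ₁, hae⟩ := exists_subseq_tendsto_ae' hmeas (hmemU _ (hcc_pos m)).1
        ((hconvU _ (hcc_pos m)).comp (tendsto_add_atTop_nat m))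
      filter_upwards [hae, ae_restrict_mem (isOpen_parabolicCylinder _ _).measurableSet] with w hw hwmem
      refine le_of_tendsto hw.norm (Eventually.of_forall fun i => ?_)
      have hle : m ≤ σ (ψ₁ i + m) + 2 := by linarith [hσge (ψ₁ i + m)]
      exact hratev _ w (hsub m _ hle hwmem)
    have hcover : (Iio (0 : ℝ) ×ˢ (univ : Set (EuclideanSpace ℝ (Fin 3)))) ⊆
        ⋃ m : ℕ, parabolicCylinder ((2 : ℝ) ^ m) (0 : ℝ × (EuclideanSpace ℝ (Fin 3))) := by
      rintro ⟨t, x⟩ ⟨ht, -⟩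
      obtain ⟨m, hm⟩ := exists_mem_parabolicCylinder_two_pow (mem_Iio.1 ht) x
      exact mem_iUnion.2 ⟨m, hm⟩
    exact ae_restrict_of_ae_restrict_of_subset hcover ((ae_restrict_iUnion_iff _ _).2 hQ)
  -- ## Step 5: the representatives (rate everywhere; continuous Oseen-mild)
  obtain ⟨U₁, hae₁, hsw₁, hwg₁, hI₁, hdec₁, hsing₁⟩ :=
    exists_rate_profile_repr hM hswU hHU h4Itop hsingU hrate_ae
  obtain ⟨U, hae₂, hUc, hUdiv, hUmild, hUrate⟩ := exists_oseenMild_repr_of_typeIBound_lt_top hsw₁ hdec₁ hI₁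
  have hae₂' : ∀ᵐ w ∂(volume.restrict ((slab (EuclideanSpace ℝ (Fin 3)) (Iio 0) isOpen_Iio :
      Opens (ℝ × (EuclideanSpace ℝ (Fin 3)))) : Set (ℝ × (EuclideanSpace ℝ (Fin 3))))),
      uncurry U₁ w = uncurry U w := by
    rw [coe_slab]
    exact hae₂
  have hswU' : IsSuitableWeakSolutionOn (slab (EuclideanSpace ℝ (Fin 3)) (Iio 0) isOpen_Iio) 1 0 U Pt :=
    hsw₁.congr_ae hae₂' (ae_of_all _ fun _ => rfl)
  have hwgU' : HasWeakSpatialGradientOn (slab (EuclideanSpace ℝ (Fin 3)) (Iio 0) isOpen_Iio) U Ht :=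
    hwg₁.congr_ae hae₂'
  have hIU' : typeIBound (Iio (0 : ℝ) ×ˢ univ) U Pt Ht < ⊤ := by
    rwa [← typeIBound_congr_ae hae₂]
  have hsingU' : IsBackwardSingularPoint U 0 :=
    hsing₁.congr_ae (fun r _ => parabolicCylinder_origin_subset_slab r) hae₂
  have hTI : IsTypeIAncientMild M U := isTypeIAncientMild_of_continuous_oseenMild_rate hUc hUdiv hUmild hUrate
  have haeU : ∀ᵐ w ∂(volume.restrict (Iio (0 : ℝ) ×ˢ (univ : Set (EuclideanSpace ℝ (Fin 3))))),
      uncurry Ut w = uncurry U w := by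
    filter_upwards [hae₁, hae₂] with w h1 h2
    rw [h1, h2]
  -- ## Step 6: the zooms shifted in time by `-1` and their `C¹_loc` convergence
  set w : ℕ → ℝ → (EuclideanSpace ℝ (Fin 3)) → (EuclideanSpace ℝ (Fin 3)) :=
    fun k => (1 : ℝ) • stPull ((1 : ℝ) ^ 2) 1 (-1) 0 (v (σ k)) with hwdef
  set qw : ℕ → ℝ → (EuclideanSpace ℝ (Fin 3)) → ℝ :=
    fun k => (1 : ℝ) ^ 2 • stPull ((1 : ℝ) ^ 2) 1 (-1) 0 (qz (σ k)) with hqw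
  set Gw : ℕ → ℝ → (EuclideanSpace ℝ (Fin 3)) → (EuclideanSpace ℝ (Fin 3)) →L[ℝ] (EuclideanSpace ℝ (Fin 3)) :=
    fun k => (1 : ℝ) ^ 2 • stPull ((1 : ℝ) ^ 2) 1 (-1) 0 (Gz (σ k)) with hGw
  have hw_apply : ∀ k s y, w k s y = v (σ k) (s - 1) y := fun k s y => by
    show ((1 : ℝ) • stPull ((1 : ℝ) ^ 2) 1 (-1) 0 (v (σ k))) s y = _
    rw [smul_stPull_apply, one_smul, one_pow, one_mul, one_smul, zero_add, neg_add_eq_sub]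
  -- the shifted points stay in the domain: `(s - 1, y) ∈ Q(0, ρ/lam (σ k))` for `(s, y) ∈ Q(0, 2^(k+1))`
  have hshift_mem : ∀ k, ∀ z ∈ parabolicCylinder ((2 : ℝ) ^ (k + 1)) (0 : ℝ × (EuclideanSpace ℝ (Fin 3))),
      ((z.1 - 1, z.2) : ℝ × (EuclideanSpace ℝ (Fin 3))) ∈
        parabolicCylinder (ρ / lam (σ k)) (0 : ℝ × (EuclideanSpace ℝ (Fin 3))) := by
    rintro k ⟨s, y⟩ hz
    have hbk : (2 : ℝ) ^ (k + 2) ≤ ρ / lam (σ k) :=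
      (pow_le_pow_right₀ (by norm_num) (by linarith [hσge k])).trans (hbig (σ k))
    rw [mem_parabolicCylinder] at hz ⊢
    simp only [Prod.fst_zero, Prod.snd_zero, zero_sub, dist_zero_right] at hz ⊢
    obtain ⟨⟨hs1, hs2⟩, hy⟩ := hz
    have h4 : (2 : ℝ) ^ (k + 2) = 2 * 2 ^ (k + 1) := by ring
    have h1 : (1 : ℝ) ≤ 2 ^ (k + 1) := one_le_pow₀ (by norm_num)
    refine ⟨⟨?_, by linarith⟩, ?_⟩
    · have h5 : ((2 : ℝ) ^ (k + 1)) ^ 2 + 1 < (ρ / lam (σ k)) ^ 2 := by nlinarith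
      linarith
    · linarith
  have hballw : ∀ m k : ℕ, m ≤ k → IsSuitableWeakSolutionInBall ((2 : ℝ) ^ m) 0 (w k) (qw k) := by
    intro m k hmk
    -- the shifted box lies in `Q(0, 2^(k+2))`, where `(v (σ k), qz (σ k))` is in the class
    have hboxsub : Icc ((((-1 : ℝ), (0 : EuclideanSpace ℝ (Fin 3))) : ℝ × (EuclideanSpace ℝ (Fin 3))).1 -
        ((2 : ℝ) ^ m) ^ 2) (((-1 : ℝ), (0 : EuclideanSpace ℝ (Fin 3))) : ℝ × (EuclideanSpace ℝ (Fin 3))).1 ×ˢ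
        closedBall (((-1 : ℝ), (0 : EuclideanSpace ℝ (Fin 3))) : ℝ × (EuclideanSpace ℝ (Fin 3))).2 ((2 : ℝ) ^ m) ⊆
        (parabolicCylinderOpens ((2 : ℝ) ^ (k + 2)) (0 : ℝ × (EuclideanSpace ℝ (Fin 3))) :
          Set (ℝ × (EuclideanSpace ℝ (Fin 3)))) := by
      rintro ⟨s, y⟩ ⟨hs, hy⟩
      simp only [mem_Icc] at hs
      rw [mem_closedBall, dist_zero_right] at hy
      show ((s, y) : ℝ × (EuclideanSpace ℝ (Fin 3))) ∈
        parabolicCylinder ((2 : ℝ) ^ (k + 2)) (0 : ℝ × (EuclideanSpace ℝ (Fin 3)))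
      rw [mem_parabolicCylinder]
      simp only [Prod.fst_zero, Prod.snd_zero, zero_sub, dist_zero_right]
      have h2 : (2 : ℝ) ^ m ≤ 2 ^ k := pow_le_pow_right₀ (by norm_num) hmk
      have h3 : (2 : ℝ) ^ (k + 2) = 4 * 2 ^ k := by ring
      have h1 : (1 : ℝ) ≤ 2 ^ k := one_le_pow₀ (by norm_num)
      refine ⟨⟨?_, by linarith [hs.2]⟩, ?_⟩
      · have : ((2 : ℝ) ^ m) ^ 2 ≤ (2 ^ k) ^ 2 := by gcongr
        nlinarith [hs.1]
      · calc ‖y‖ ≤ (2 : ℝ) ^ m := hy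
          _ < (2 : ℝ) ^ (k + 2) := by rw [h3]; nlinarith
    have hIn : IsSuitableWeakSolutionInBall ((2 : ℝ) ^ m) ((-1 : ℝ), (0 : EuclideanSpace ℝ (Fin 3)))
        (v (σ k)) (qz (σ k)) :=
      (hballs (k + 2) (σ k) (by linarith [hσge k])).1.isSuitableWeakSolutionInBall hboxsub
    have h1 := hIn.zoom (hcc_pos m)
    have h2 := h1.zoomOut (c := ((2 : ℝ) ^ m)⁻¹) (inv_pos.2 (hcc_pos m))
    rw [zoom_zoom, zoom_zoom, inv_mul_cancel₀ (hcc_pos m).ne', one_div, inv_inv,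
      show ((2 : ℝ) ^ m)⁻¹ ^ 2 * ((2 : ℝ) ^ m) ^ 2 = (1 : ℝ) ^ 2 by
        rw [← mul_pow, inv_mul_cancel₀ (hcc_pos m).ne']] at h2
    exact h2
  have hbdw : ∀ m k : ℕ, m ≤ k →
      typeIBound (parabolicCylinder ((2 : ℝ) ^ m) (0 : ℝ × (EuclideanSpace ℝ (Fin 3)))) (w k) (qw k) (Gw k) ≤ I := by
    intro m k hmk
    have h := typeIBound_nsZoom (c := (1 : ℝ)) one_pos (-1) (0 : EuclideanSpace ℝ (Fin 3))
      (parabolicCylinder ((2 : ℝ) ^ (k + 2)) (0 : ℝ × (EuclideanSpace ℝ (Fin 3)))) (v (σ k)) (qz (σ k)) (Gz (σ k))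
    have hsubpre : parabolicCylinder ((2 : ℝ) ^ m) (0 : ℝ × (EuclideanSpace ℝ (Fin 3))) ⊆
        stAffine ((1 : ℝ) ^ 2) 1 (-1) (0 : EuclideanSpace ℝ (Fin 3)) ⁻¹'
          parabolicCylinder ((2 : ℝ) ^ (k + 2)) (0 : ℝ × (EuclideanSpace ℝ (Fin 3))) := by
      rintro ⟨s, y⟩ hsy
      rw [mem_preimage, stAffine_apply, one_pow, one_mul, one_smul, zero_add]
      rw [mem_parabolicCylinder] at hsy ⊢
      simp only [Prod.fst_zero, Prod.snd_zero, zero_sub, dist_zero_right] at hsy ⊢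
      obtain ⟨⟨hs1, hs2⟩, hy⟩ := hsy
      have h2 : (2 : ℝ) ^ m ≤ 2 ^ k := pow_le_pow_right₀ (by norm_num) hmk
      have h3 : (2 : ℝ) ^ (k + 2) = 4 * 2 ^ k := by ring
      have h1 : (1 : ℝ) ≤ 2 ^ k := one_le_pow₀ (by norm_num)
      refine ⟨⟨?_, by linarith⟩, ?_⟩
      · have : ((2 : ℝ) ^ m) ^ 2 ≤ (2 ^ k) ^ 2 := by gcongr
        nlinarith
      · calc ‖y‖ < (2 : ℝ) ^ m := hy
          _ ≤ (2 : ℝ) ^ (k + 2) := by rw [h3]; nlinarith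
    calc typeIBound (parabolicCylinder ((2 : ℝ) ^ m) (0 : ℝ × (EuclideanSpace ℝ (Fin 3)))) (w k) (qw k) (Gw k)
        ≤ typeIBound (stAffine ((1 : ℝ) ^ 2) 1 (-1) (0 : EuclideanSpace ℝ (Fin 3)) ⁻¹'
            parabolicCylinder ((2 : ℝ) ^ (k + 2)) (0 : ℝ × (EuclideanSpace ℝ (Fin 3)))) (w k) (qw k) (Gw k) :=
          typeIBound_mono hsubpre
      _ = typeIBound (parabolicCylinder ((2 : ℝ) ^ (k + 2)) (0 : ℝ × (EuclideanSpace ℝ (Fin 3))))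
            (v (σ k)) (qz (σ k)) (Gz (σ k)) := h
      _ ≤ I := hIs (k + 2) (σ k) (by linarith [hσge k])
  have hMw : ∀ k, ∀ᵐ z ∂(volume.restrict (parabolicCylinder ((2 : ℝ) ^ k) (0 : ℝ × (EuclideanSpace ℝ (Fin 3))))),
      ‖w k z.1 z.2‖ ≤ M := by
    intro k
    filter_upwards [ae_restrict_mem (isOpen_parabolicCylinder _ _).measurableSet] with z hz
    rw [hw_apply]
    have hz' : z ∈ parabolicCylinder ((2 : ℝ) ^ (k + 1)) (0 : ℝ × (EuclideanSpace ℝ (Fin 3))) :=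
      parabolicCylinder_mono (hcc_pos k).le (pow_le_pow_right₀ (by norm_num) (Nat.le_succ k)) _ hz
    have hz0 : z.1 < 0 := by
      rw [mem_parabolicCylinder] at hz
      simpa using hz.1.2
    have h := hratev (σ k) _ (hshift_mem k z hz')
    refine h.trans (div_le_self hM ?_)
    show (1 : ℝ) ≤ Real.sqrt (-(z.1 - 1))
    refine (Real.le_sqrt zero_le_one (by linarith)).2 ?_
    rw [one_pow]
    linarith
  -- the limit candidate: the shifted representative
  set Ush : ℝ → (EuclideanSpace ℝ (Fin 3)) → (EuclideanSpace ℝ (Fin 3)) :=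
    (1 : ℝ) • stPull ((1 : ℝ) ^ 2) 1 (-1) 0 U with hUshdef
  have hUsh_apply : ∀ s y, Ush s y = U (s - 1) y := fun s y => by
    show ((1 : ℝ) • stPull ((1 : ℝ) ^ 2) 1 (-1) 0 U) s y = _
    rw [smul_stPull_apply, one_smul, one_pow, one_mul, one_smul, zero_add, neg_add_eq_sub]
  have hUsh_cont : ContinuousOn (uncurry Ush) (Iio 0 ×ˢ univ) := by
    have e : uncurry Ush = uncurry U ∘ fun q : ℝ × (EuclideanSpace ℝ (Fin 3)) => (q.1 - 1, q.2) := by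
      funext q
      simp only [comp_apply, uncurry, hUsh_apply]
    rw [e]
    refine hUc.comp ((continuous_fst.sub continuous_const).prodMk continuous_snd).continuousOn ?_
    intro q hq
    rw [mem_prod, mem_Iio] at hq ⊢
    exact ⟨by linarith [hq.1], mem_univ _⟩
  have hQslab : ∀ r : ℝ, parabolicCylinder r (0 : ℝ × (EuclideanSpace ℝ (Fin 3))) ⊆ Iio 0 ×ˢ univ :=
    fun r => parabolicCylinder_origin_subset_slab r
  have hUm : ∀ r : ℝ, 0 < r → AEStronglyMeasurable (uncurry Ush)
      (volume.restrict (parabolicCylinder r (0 : ℝ × (EuclideanSpace ℝ (Fin 3))))) := fun r _ =>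
    (hUsh_cont.mono (hQslab r)).aestronglyMeasurable (isOpen_parabolicCylinder _ _).measurableSet
  -- strong `L³` convergence of the shifted zooms
  have hconvw : ∀ r : ℝ, 0 < r → Tendsto (fun k => eLpNorm (uncurry (w k) - uncurry Ush) 3
      (volume.restrict (parabolicCylinder r (0 : ℝ × (EuclideanSpace ℝ (Fin 3)))))) atTop (𝓝 0) := by
    intro r hr
    have hpreR : stAffine ((1 : ℝ) ^ 2) 1 (-1) (0 : EuclideanSpace ℝ (Fin 3)) ⁻¹'
        parabolicCylinder r ((-1 : ℝ), (0 : EuclideanSpace ℝ (Fin 3))) =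
          parabolicCylinder r (0 : ℝ × (EuclideanSpace ℝ (Fin 3))) := by
      have h := LocalTypeIScaling.stAffine_preimage_parabolicCylinder (c := (1 : ℝ)) one_pos (-1)
        (0 : EuclideanSpace ℝ (Fin 3)) r (0 : ℝ × (EuclideanSpace ℝ (Fin 3)))
      have e0 : stAffine ((1 : ℝ) ^ 2) 1 (-1) (0 : EuclideanSpace ℝ (Fin 3)) (0 : ℝ × (EuclideanSpace ℝ (Fin 3))) =
          ((-1 : ℝ), (0 : EuclideanSpace ℝ (Fin 3))) := by
        rw [show (0 : ℝ × (EuclideanSpace ℝ (Fin 3))) = ((0 : ℝ), (0 : EuclideanSpace ℝ (Fin 3))) from rfl,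
          stAffine_apply, mul_zero, add_zero, smul_zero, add_zero]
      rwa [one_mul, e0] at h
    have hsubR : parabolicCylinder r ((-1 : ℝ), (0 : EuclideanSpace ℝ (Fin 3))) ⊆
        parabolicCylinder (r + 1) (0 : ℝ × (EuclideanSpace ℝ (Fin 3))) := by
      rintro ⟨s, y⟩ h
      rw [mem_parabolicCylinder] at h ⊢
      simp only [Prod.fst_zero, Prod.snd_zero, zero_sub, dist_zero_right] at h ⊢
      obtain ⟨⟨hs1, hs2⟩, hy⟩ := h
      exact ⟨⟨by nlinarith, by linarith⟩, by linarith⟩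
    have e : ∀ k, eLpNorm (uncurry (w k) - uncurry Ush) 3
        (volume.restrict (parabolicCylinder r (0 : ℝ × (EuclideanSpace ℝ (Fin 3))))) =
        eLpNorm (uncurry (v (σ k)) - uncurry U) 3
          (volume.restrict (parabolicCylinder r ((-1 : ℝ), (0 : EuclideanSpace ℝ (Fin 3))))) := by
      intro k
      have h := eLpNorm_comp_stAffine_preimage (β := (1 : ℝ) ^ 2) (γ := (1 : ℝ)) (by positivity) one_pos (-1)
        (0 : EuclideanSpace ℝ (Fin 3)) (uncurry (v (σ k)) - uncurry U)
        (parabolicCylinder r ((-1 : ℝ), (0 : EuclideanSpace ℝ (Fin 3)))) (q := 3) (by norm_num) (by norm_num)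
      rw [hpreR] at h
      have hfun : uncurry (w k) - uncurry Ush =
          (uncurry (v (σ k)) - uncurry U) ∘ stAffine ((1 : ℝ) ^ 2) 1 (-1) (0 : EuclideanSpace ℝ (Fin 3)) := by
        funext z
        rcases z with ⟨s, y⟩
        simp only [Pi.sub_apply, comp_apply, uncurry_apply_pair, stAffine_apply, hw_apply, hUsh_apply,
          one_pow, one_mul, one_smul, zero_add, neg_add_eq_sub]
      rw [hfun, h]
      simp
    simp_rw [e]
    have hle : ∀ k, eLpNorm (uncurry (v (σ k)) - uncurry U) 3
        (volume.restrict (parabolicCylinder r ((-1 : ℝ), (0 : EuclideanSpace ℝ (Fin 3))))) ≤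
        eLpNorm (uncurry (v (σ k)) - uncurry Ut) 3
          (volume.restrict (parabolicCylinder (r + 1) (0 : ℝ × (EuclideanSpace ℝ (Fin 3))))) := by
      intro k
      calc eLpNorm (uncurry (v (σ k)) - uncurry U) 3
            (volume.restrict (parabolicCylinder r ((-1 : ℝ), (0 : EuclideanSpace ℝ (Fin 3)))))
          ≤ eLpNorm (uncurry (v (σ k)) - uncurry U) 3
            (volume.restrict (parabolicCylinder (r + 1) (0 : ℝ × (EuclideanSpace ℝ (Fin 3))))) :=
            eLpNorm_mono_measure _ (Measure.restrict_mono hsubR le_rfl)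
        _ = eLpNorm (uncurry (v (σ k)) - uncurry Ut) 3
            (volume.restrict (parabolicCylinder (r + 1) (0 : ℝ × (EuclideanSpace ℝ (Fin 3))))) := by
            refine eLpNorm_congr_ae ?_
            filter_upwards [ae_restrict_of_ae_restrict_of_subset (hQslab (r + 1)) haeU] with z hz
            simp only [Pi.sub_apply, hz]
    exact tendsto_of_tendsto_of_tendsto_of_le_of_le tendsto_const_nhds (hconvU (r + 1) (by linarith))
      (fun _ => bot_le) hle
  obtain ⟨ψ, V, W, hψ, hVae, hVc, -, hUW, hWc, -, hpt, -, hcurl⟩ :=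
    exists_subseq_curl_limit hI hballw hbdw hMw hUm hconvw
  -- ## Step 7: identification of the representatives with the zooms and with `U`
  have hWU : EqOn (uncurry Ush) (uncurry W) (Iio 0 ×ˢ univ) :=
    Measure.eqOn_open_of_ae_eq hUW (isOpen_Iio.prod isOpen_univ) hUsh_cont hWc
  have hwc : ∀ k, ContinuousOn (uncurry (w k))
      (parabolicCylinder ((2 : ℝ) ^ (k + 1)) (0 : ℝ × (EuclideanSpace ℝ (Fin 3)))) := by
    intro k
    have e : uncurry (w k) = uncurry (v (σ k)) ∘ fun q : ℝ × (EuclideanSpace ℝ (Fin 3)) => (q.1 - 1, q.2) := by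
      funext q
      simp only [comp_apply, uncurry, hw_apply]
    rw [e]
    exact (hvc (σ k)).comp ((continuous_fst.sub continuous_const).prodMk continuous_snd).continuousOn
      fun q hq => hshift_mem k q hq
  have hVw : ∀ j, EqOn (uncurry (w (ψ j))) (uncurry (V j))
      (parabolicCylinder ((2 : ℝ) ^ (ψ j)) (0 : ℝ × (EuclideanSpace ℝ (Fin 3)))) := fun j =>
    Measure.eqOn_open_of_ae_eq (hVae j) (isOpen_parabolicCylinder _ _)
      ((hwc (ψ j)).mono (parabolicCylinder_mono (hcc_pos _).le
        (pow_le_pow_right₀ (by norm_num) (Nat.le_succ _)) _)) (hVc j)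
  have hevQ : ∀ t < 0, ∀ x : EuclideanSpace ℝ (Fin 3), ∀ᶠ j in atTop,
      ((t, x) : ℝ × (EuclideanSpace ℝ (Fin 3))) ∈ parabolicCylinder ((2 : ℝ) ^ (ψ j)) (0 : ℝ × (EuclideanSpace ℝ (Fin 3))) := by
    intro t ht x
    obtain ⟨m, hm⟩ := exists_mem_parabolicCylinder_two_pow ht x
    filter_upwards [eventually_ge_atTop m] with j hj
    exact parabolicCylinder_mono (hcc_pos m).le (pow_le_pow_right₀ (by norm_num) (hj.trans (hψ.id_le j))) _ hm
  have hptw : ∀ t < 0, ∀ x, Tendsto (fun j => w (ψ j) t x) atTop (𝓝 (Ush t x)) := by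
    intro t ht x
    have e : Ush t x = W t x := hWU (mk_mem_prod (mem_Iio.2 ht) (mem_univ x))
    rw [e]
    refine (hpt t ht x).congr' ?_
    filter_upwards [hevQ t ht x] with j hj
    exact (hVw j hj).symm
  have hcurlw : ∀ t < 0, ∀ x, Tendsto (fun j => curl (w (ψ j) t) x) atTop (𝓝 (curl (Ush t) x)) := by
    intro t ht x
    have e : Ush t = W t := funext fun y => hWU (mk_mem_prod (mem_Iio.2 ht) (mem_univ y))
    rw [e]
    refine (hcurl t ht x).congr' ?_
    filter_upwards [hevQ t ht x] with j hj
    have hopen : IsOpen {y : EuclideanSpace ℝ (Fin 3) |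
        ((t, y) : ℝ × (EuclideanSpace ℝ (Fin 3))) ∈ parabolicCylinder ((2 : ℝ) ^ (ψ j)) (0 : ℝ × (EuclideanSpace ℝ (Fin 3)))} :=
      (isOpen_parabolicCylinder _ _).preimage (continuous_const.prodMk continuous_id)
    have hev : V j t =ᶠ[𝓝 x] w (ψ j) t := by
      filter_upwards [hopen.mem_nhds hj] with y hy
      exact (hVw j hy).symm
    rw [curl_eq_curlCLM, curl_eq_curlCLM, hev.fderiv_eq]
  -- ## conclusion: reindex to the unshifted times `s = t - 1 < -1`
  refine ⟨fun j => φ₀ (σ (ψ j)), hφ₀.comp (hσ.comp hψ), U, Pt, Ht, hTI, hswU', hwgU', hIU', hsingU',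
    fun r hr => ?_, fun s hs y => ?_, fun s hs y => ?_⟩
  · -- strong `L³_loc` convergence of the zooms along the final subsequence
    have h1 : Tendsto (fun j => eLpNorm (uncurry (v (σ (ψ j))) - uncurry Ut) 3
        (volume.restrict (parabolicCylinder r (0 : ℝ × (EuclideanSpace ℝ (Fin 3)))))) atTop (𝓝 0) :=
      (hconvU r hr).comp hψ.tendsto_atTop
    refine h1.congr fun j => ?_
    refine eLpNorm_congr_ae ?_
    filter_upwards [ae_restrict_of_ae_restrict_of_subset (hQslab r) haeU] with z hz
    simp only [Pi.sub_apply, hz]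
    rfl
  · have h := hptw (s + 1) (by linarith) y
    rw [hUsh_apply, add_sub_cancel_right] at h
    refine h.congr fun j => ?_
    rw [hw_apply, add_sub_cancel_right]
    rfl
  · have h := hcurlw (s + 1) (by linarith) y
    have e1 : Ush (s + 1) = U s := funext fun y' => by rw [hUsh_apply, add_sub_cancel_right]
    rw [e1] at h
    refine h.congr fun j => ?_
    have e2 : w (ψ j) (s + 1) = v (σ (ψ j)) s := funext fun y' => by rw [hw_apply, add_sub_cancel_right]
    rw [e2]
    show curl ((lam (σ (ψ j)) • stPull (lam (σ (ψ j)) ^ 2) (lam (σ (ψ j))) (z₀ (φ₀ (σ (ψ j)))).1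
      (z₀ (φ₀ (σ (ψ j)))).2 (u (φ₀ (σ (ψ j))))) s) y = _
    rw [curl_smul_stPull, ← sq]
end Literature.Analysis.FluidPDE.LocalTypeIBlowup

end
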